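import Mathlib
import HarnessLib
import Literature.Analysis.FluidPDE.TypeIAncientMild
import Literature.Analysis.FluidPDE.OseenSlice
import Literature.Analysis.FluidPDE.UlocKernelEstimates
import Literature.Analysis.FluidPDE.LerayVolterraComparison
import Summits.NavierStokesRegularity.NavierStokesRegularity.Theorems.QuarterLogPincerTruncationEdgeDefs
import Summits.NavierStokesRegularity.NavierStokesRegularity.Theorems.QuarterLogPincerQuietCoreDefs

/-!
# Route `QuarterLogPincer`, crux `TypeIQuantSubcubicExp` (stmt-NavierStokesRegularity-24077), line `quiet_core` §1b Part A
# (ns-idea-7 g10, PROVED in-file v1.1; ported VERBATIM): elementary weights and the three-region Oseen slice bound at a core point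

`jFour`, `jSeven`, the weight inequalities, and `norm_oseenSlice_core` (one proof line deviates: the line's
`integrable_one_add_norm_neg_four` duplicates a landed tree lemma and is inlined from Mathlib's `integrable_one_add_norm`) — the per-slice Oseen estimate at a core point used by the
budget pass S4♭ (`…QuietCoreBudgetPass.lean`).  Bodies are the line's (tree sha12 d1a96bf31391 (v1.5)), namespace
`…Cruxes.TypeIQuantSubcubicExp.QuietCore`.  HONEST FRAME: estimates about HYPOTHETICAL Type-I ancient mild fields; nothing here
bears on 24077, W7 or Navier–Stokes regularity (OPEN).  Port by the pub-ns-dss typer (g36), DIRECTOR-NS KEY-NS #181/#182.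
-/

noncomputable section

set_option linter.dupNamespace false

namespace Summit.NavierStokesRegularity.NavierStokesRegularity.Cruxes.TypeIQuantSubcubicExp.QuietCore

open MeasureTheory Set Function Metric Filter Topology
open scoped ENNReal NNReal
open Literature.Analysis Literature.Analysis.FluidPDE
open Summit.NavierStokesRegularity.NavierStokesRegularity.Cruxes.TypeIQuantSubcubicExp.TruncationEdge

/-! ### §1b  S4♭ PROVED (v1.1).  Part A: elementary weights and the three-region Oseen slice bound at a core point -/

/-- `J₄ = ∫_{ℝ³} (1+‖z‖)^{-4} dz`. -/
noncomputable def jFour : ℝ := ∫ z : EuclideanSpace ℝ (Fin 3), (1 + ‖z‖) ^ (-(4 : ℝ))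

/-- `J₇ = ∫_{ℝ³} (1+‖z‖)^{-7/2} dz`. -/
noncomputable def jSeven : ℝ := ∫ z : EuclideanSpace ℝ (Fin 3), (1 + ‖z‖) ^ (-(7 / 2 : ℝ))

/-- `jFour_nonneg` (line `quiet_core` §1b, ns-idea-7 g10; ported verbatim). [this file] -/
theorem jFour_nonneg : 0 ≤ jFour :=
  integral_nonneg fun z => Real.rpow_nonneg (by positivity) _

/-- `jSeven_nonneg` (line `quiet_core` §1b, ns-idea-7 g10; ported verbatim). [this file] -/
theorem jSeven_nonneg : 0 ≤ jSeven :=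
  integral_nonneg fun z => Real.rpow_nonneg (by positivity) _

/-- `integrable_one_add_norm_neg_sevenHalves` (line `quiet_core` §1b, ns-idea-7 g10; ported verbatim). [this file] -/
theorem integrable_one_add_norm_neg_sevenHalves :
    Integrable (fun z : EuclideanSpace ℝ (Fin 3) => (1 + ‖z‖) ^ (-(7 / 2 : ℝ))) := by
  refine integrable_one_add_norm ?_
  rw [finrank_euclideanSpace_fin]; norm_num

/-- `a² ≤ a³ + 1` for `a ≥ 0`. -/
theorem sq_le_cube_add_one {a : ℝ} (ha : 0 ≤ a) : a ^ 2 ≤ a ^ 3 + 1 := by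
  rcases le_or_gt a 1 with h | h
  · have h1 : a ^ 2 ≤ 1 := pow_le_one₀ ha h
    have h2 : 0 ≤ a ^ 3 := by positivity
    linarith
  · have h1 : a ^ 2 ≤ a ^ 3 := by nlinarith [sq_nonneg a, mul_nonneg (sq_nonneg a) (sub_nonneg.2 h.le)]
    linarith

/-- The kernel weight against the bare distance: `(σ + d²)^{-2} ≤ 1/d⁴` (`σ > 0`, `d > 0`). -/
theorem weight_le_one_div_pow_four {σ d : ℝ} (hσ : 0 < σ) (hd : 0 < d) :
    (σ + d ^ 2) ^ (-(2 : ℝ)) ≤ 1 / d ^ 4 := by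
  rw [Real.rpow_neg (by positivity), show (2 : ℝ) = ((2 : ℕ) : ℝ) by norm_num, Real.rpow_natCast,
    ← one_div]
  apply one_div_le_one_div_of_le (by positivity)
  nlinarith [sq_nonneg d, hσ.le, sq_nonneg (d ^ 2)]

/-- Middle region: `1/d⁴ ≤ 256` for `d ≥ 1/4`. -/
theorem one_div_pow_four_le {d : ℝ} (hd : 1 / 4 ≤ d) : 1 / d ^ 4 ≤ 256 := by
  have hd0 : 0 < d := by linarith
  rw [div_le_iff₀ (by positivity)]
  have h4 : (1 / 4 : ℝ) ^ 4 ≤ d ^ 4 := pow_le_pow_left₀ (by norm_num) hd 4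
  nlinarith [h4]

/-- Middle region: `1/d⁴ ≤ 625 (1+d)^{-4}` for `d ≥ 1/4` (`1 + d ≤ 5d`). -/
theorem one_div_pow_four_le_one_add {d : ℝ} (hd : 1 / 4 ≤ d) :
    1 / d ^ 4 ≤ 625 * (1 + d) ^ (-(4 : ℝ)) := by
  have hd0 : 0 < d := by linarith
  have h1d : 0 < 1 + d := by linarith
  rw [Real.rpow_neg h1d.le, show (4 : ℝ) = ((4 : ℕ) : ℝ) by norm_num, Real.rpow_natCast,
    ← div_eq_mul_inv, div_le_div_iff₀ (by positivity) (by positivity), one_mul]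
  have h5 : 1 + d ≤ 5 * d := by linarith
  have h54 : (1 + d) ^ 4 ≤ (5 * d) ^ 4 := pow_le_pow_left₀ h1d.le h5 4
  nlinarith [h54]

/-- Far region: for `1 ≤ R ≤ r` and `r/2 ≤ d`, `σ > 0`:
`(σ + d²)^{-2} ≤ 16 · 2^{7/2} · R^{-1/2} · (1 + r)^{-7/2}`. -/
theorem weight_far_le {σ r d R : ℝ} (hσ : 0 < σ) (hR : 1 ≤ R) (hr : R ≤ r) (hd : r / 2 ≤ d) :
    (σ + d ^ 2) ^ (-(2 : ℝ)) ≤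
      16 * (2 : ℝ) ^ (7 / 2 : ℝ) * R ^ (-(1 / 2 : ℝ)) * (1 + r) ^ (-(7 / 2 : ℝ)) := by
  have hr1 : 1 ≤ r := hR.trans hr
  have hr0 : 0 < r := by linarith
  have hd0 : 0 < d := by linarith
  -- step 1: `(σ+d²)^{-2} ≤ 1/d⁴ ≤ 16/r⁴`
  have h1 : (σ + d ^ 2) ^ (-(2 : ℝ)) ≤ 16 * (1 / r ^ 4) := by
    refine (weight_le_one_div_pow_four hσ hd0).trans ?_
    rw [mul_one_div, div_le_div_iff₀ (by positivity) (by positivity), one_mul]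
    have : (r / 2) ^ 4 ≤ d ^ 4 := pow_le_pow_left₀ (by positivity) hd 4
    nlinarith [this]
  -- step 2: `1/r⁴ = r^{-1/2} r^{-7/2}`, `r^{-1/2} ≤ R^{-1/2}`, `r^{-7/2} ≤ 2^{7/2}(1+r)^{-7/2}`
  have h2 : 1 / r ^ 4 = r ^ (-(1 / 2 : ℝ)) * r ^ (-(7 / 2 : ℝ)) := by
    rw [← Real.rpow_add hr0, show (-(1 / 2 : ℝ)) + -(7 / 2 : ℝ) = -((4 : ℕ) : ℝ) by norm_num,
      Real.rpow_neg hr0.le, Real.rpow_natCast, one_div]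
  have h3 : r ^ (-(1 / 2 : ℝ)) ≤ R ^ (-(1 / 2 : ℝ)) :=
    Real.rpow_le_rpow_of_nonpos (by linarith) hr (by norm_num)
  have h4 : r ^ (-(7 / 2 : ℝ)) ≤ (2 : ℝ) ^ (7 / 2 : ℝ) * (1 + r) ^ (-(7 / 2 : ℝ)) := by
    have h12 : 1 + r ≤ 2 * r := by linarith
    have hpow : (1 + r) ^ (7 / 2 : ℝ) ≤ (2 * r) ^ (7 / 2 : ℝ) :=
      Real.rpow_le_rpow (by linarith) h12 (by norm_num)
    rw [Real.mul_rpow (by norm_num) hr0.le] at hpow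
    have hA : 0 < r ^ (7 / 2 : ℝ) := Real.rpow_pos_of_pos hr0 _
    have hB : 0 < (1 + r) ^ (7 / 2 : ℝ) := Real.rpow_pos_of_pos (by linarith) _
    rw [Real.rpow_neg hr0.le, Real.rpow_neg (by linarith), ← div_eq_mul_inv, ← one_div,
      div_le_div_iff₀ hA hB, one_mul]
    linarith [hpow]
  have h5 : 0 ≤ r ^ (-(7 / 2 : ℝ)) := Real.rpow_nonneg hr0.le _
  have h6 : 0 ≤ R ^ (-(1 / 2 : ℝ)) := Real.rpow_nonneg (by linarith) _
  calc (σ + d ^ 2) ^ (-(2 : ℝ)) ≤ 16 * (1 / r ^ 4) := h1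
    _ = 16 * (r ^ (-(1 / 2 : ℝ)) * r ^ (-(7 / 2 : ℝ))) := by rw [h2]
    _ ≤ 16 * (R ^ (-(1 / 2 : ℝ)) * ((2 : ℝ) ^ (7 / 2 : ℝ) * (1 + r) ^ (-(7 / 2 : ℝ)))) := by
        gcongr
    _ = 16 * (2 : ℝ) ^ (7 / 2 : ℝ) * R ^ (-(1 / 2 : ℝ)) * (1 + r) ^ (-(7 / 2 : ℝ)) := by ring

/-- **Three-region slice bound at a core point.**  Let `‖x‖ < 1/2`, `σ > 0`, `R ≥ 1`.  If `‖a(y)‖² ≤ P` on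
`‖y‖ < 3/4`, `‖a‖ ≤ Mf` everywhere, and `∫_{B(0,R)} ‖a‖³ ≤ Q` (integrable there), then
`‖N_σ[a,a](x)‖ ≤ C P I σ^{-1/2} + 256 C Q + 625 C J₄ + 16·2^{7/2} C Mf² R^{-1/2} J₇`:
near sources by the `L¹` size of the kernel, middle sources (`3/4 ≤ ‖y‖ < R`, distance `≥ 1/4`) by
`‖a‖² ≤ ‖a‖³ + 1` against the bounded kernel, far sources (`‖y‖ ≥ R`) by the kernel decay `16/‖y‖⁴`. -/
theorem norm_oseenSlice_core {C : ℝ} (hC : 0 < C)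
    (hK : ∀ {τ : ℝ}, 0 < τ → ∀ z a b : EuclideanSpace ℝ (Fin 3),
      ‖oseenKernel τ z a b‖ ≤ C * (τ + ‖z‖ ^ 2) ^
        (-(((Module.finrank ℝ (EuclideanSpace ℝ (Fin 3)) : ℝ) + 1) / 2)) * ‖a‖ * ‖b‖)
    {σ P Mf Q R : ℝ} (hσ : 0 < σ) (hP : 0 ≤ P) (_hMf : 0 ≤ Mf) (hR : 1 ≤ R)
    {a : EuclideanSpace ℝ (Fin 3) → EuclideanSpace ℝ (Fin 3)}
    (hnear : ∀ y, ‖y‖ < 3 / 4 → ‖a y‖ ^ 2 ≤ P)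
    (hfar : ∀ y, ‖a y‖ ≤ Mf)
    (hint : IntegrableOn (fun y => ‖a y‖ ^ 3) (Metric.ball (0 : EuclideanSpace ℝ (Fin 3)) R))
    (hQ : ∫ y in Metric.ball (0 : EuclideanSpace ℝ (Fin 3)) R, ‖a y‖ ^ 3 ≤ Q)
    {x : EuclideanSpace ℝ (Fin 3)} (hx : ‖x‖ < 1 / 2) :
    ‖oseenSlice σ a a x‖ ≤
      C * P * (∫ w : EuclideanSpace ℝ (Fin 3), (1 + ‖w‖ ^ 2) ^
          (-(((Module.finrank ℝ (EuclideanSpace ℝ (Fin 3)) : ℝ) + 1) / 2))) * σ ^ (-(1 / 2 : ℝ)) +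
      256 * C * Q + 625 * C * jFour +
      16 * (2 : ℝ) ^ (7 / 2 : ℝ) * C * Mf ^ 2 * R ^ (-(1 / 2 : ℝ)) * jSeven := by
  set e : ℝ := ((Module.finrank ℝ (EuclideanSpace ℝ (Fin 3)) : ℝ) + 1) / 2 with he_def
  have he : e = 2 := oseen_exponent_eq_two
  set I : ℝ := ∫ w : EuclideanSpace ℝ (Fin 3), (1 + ‖w‖ ^ 2) ^ (-e) with hI_def
  set BR : Set (EuclideanSpace ℝ (Fin 3)) := Metric.ball 0 R with hBR_def
  have hBm : MeasurableSet BR := measurableSet_ball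
  set L : ℝ := 16 * (2 : ℝ) ^ (7 / 2 : ℝ) * C * Mf ^ 2 * R ^ (-(1 / 2 : ℝ)) with hL_def
  have hL0 : 0 ≤ L := by
    have : 0 ≤ R ^ (-(1 / 2 : ℝ)) := Real.rpow_nonneg (by linarith) _
    rw [hL_def]; positivity
  -- the majorant: near + (middle cube + middle kernel) + far
  set h₁ : EuclideanSpace ℝ (Fin 3) → ℝ := fun y => C * P * (σ + ‖x - y‖ ^ 2) ^ (-e) with hh₁
  set h₂ : EuclideanSpace ℝ (Fin 3) → ℝ := fun y => 256 * C * BR.indicator (fun y => ‖a y‖ ^ 3) y with hh₂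
  set h₃ : EuclideanSpace ℝ (Fin 3) → ℝ := fun y => 625 * C * (1 + ‖x - y‖) ^ (-(4 : ℝ)) with hh₃
  set h₄ : EuclideanSpace ℝ (Fin 3) → ℝ := fun y => L * (1 + ‖y‖) ^ (-(7 / 2 : ℝ)) with hh₄
  have hi₁ : Integrable h₁ :=
    ((integrable_add_norm_sq_rpow_neg_half_succ (E := EuclideanSpace ℝ (Fin 3)) hσ).comp_sub_left x).const_mul
      (C * P)
  have hi₂ : Integrable h₂ := (hint.integrable_indicator hBm).const_mul (256 * C)
  -- (the line's `integrable_one_add_norm_neg_four` ≡ tree `…Theorems.integrable_one_add_norm_neg_four` (dedup); inlined from Mathlib)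
  have hi₃ : Integrable h₃ :=
    ((integrable_one_add_norm (E := EuclideanSpace ℝ (Fin 3)) (r := 4)
      (by rw [finrank_euclideanSpace, Fintype.card_fin]; norm_num)).comp_sub_left x).const_mul (625 * C)
  have hi₄ : Integrable h₄ := integrable_one_add_norm_neg_sevenHalves.const_mul L
  have hnn₁ : ∀ y, 0 ≤ h₁ y := fun y => by
    rw [hh₁]; exact mul_nonneg (by positivity) (Real.rpow_nonneg (by positivity) _)
  have hnn₂ : ∀ y, 0 ≤ h₂ y := fun y => by
    rw [hh₂]
    refine mul_nonneg (by positivity) (Set.indicator_nonneg (fun z _ => by positivity) y)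
  have hnn₃ : ∀ y, 0 ≤ h₃ y := fun y => by
    rw [hh₃]; exact mul_nonneg (by positivity) (Real.rpow_nonneg (by positivity) _)
  have hnn₄ : ∀ y, 0 ≤ h₄ y := fun y => by
    rw [hh₄]; exact mul_nonneg hL0 (Real.rpow_nonneg (by positivity) _)
  -- pointwise bound of the kernel integrand by `h₁ + h₂ + h₃ + h₄`
  have hptw : ∀ y, ‖oseenKernel σ (x - y) (a y) (a y)‖ ≤ ((h₁ y + h₂ y) + h₃ y) + h₄ y := by
    intro y
    have hk := hK hσ (x - y) (a y) (a y)
    have hw0 : 0 ≤ (σ + ‖x - y‖ ^ 2) ^ (-e) := Real.rpow_nonneg (by positivity) _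
    have hk' : ‖oseenKernel σ (x - y) (a y) (a y)‖ ≤ C * (σ + ‖x - y‖ ^ 2) ^ (-e) * ‖a y‖ ^ 2 := by
      calc ‖oseenKernel σ (x - y) (a y) (a y)‖ ≤ C * (σ + ‖x - y‖ ^ 2) ^ (-e) * ‖a y‖ * ‖a y‖ := hk
        _ = C * (σ + ‖x - y‖ ^ 2) ^ (-e) * ‖a y‖ ^ 2 := by ring
    by_cases hy : ‖y‖ < 3 / 4
    · -- near source
      have h1 : C * (σ + ‖x - y‖ ^ 2) ^ (-e) * ‖a y‖ ^ 2 ≤ h₁ y := by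
        rw [hh₁]
        have := hnear y hy
        calc C * (σ + ‖x - y‖ ^ 2) ^ (-e) * ‖a y‖ ^ 2 ≤ C * (σ + ‖x - y‖ ^ 2) ^ (-e) * P :=
              mul_le_mul_of_nonneg_left this (by positivity)
          _ = C * P * (σ + ‖x - y‖ ^ 2) ^ (-e) := by ring
      linarith [hk', h1, hnn₂ y, hnn₃ y, hnn₄ y]
    · have hy' : 3 / 4 ≤ ‖y‖ := not_lt.1 hy
      by_cases hyR : ‖y‖ < R
      · -- middle source: distance ≥ 1/4, `‖a‖² ≤ ‖a‖³ + 1`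
        have hyB : y ∈ BR := by rw [hBR_def]; exact mem_ball_zero_iff.2 hyR
        have hd : 1 / 4 ≤ ‖x - y‖ := by linarith [norm_sub_norm_le y x, norm_sub_rev x y, hx, hy']
        have hd0 : 0 < ‖x - y‖ := by linarith
        have hwe : (σ + ‖x - y‖ ^ 2) ^ (-e) ≤ 1 / ‖x - y‖ ^ 4 := by
          rw [he]; exact weight_le_one_div_pow_four hσ hd0
        have hw256 : (σ + ‖x - y‖ ^ 2) ^ (-e) ≤ 256 := hwe.trans (one_div_pow_four_le hd)
        have hw625 : (σ + ‖x - y‖ ^ 2) ^ (-e) ≤ 625 * (1 + ‖x - y‖) ^ (-(4 : ℝ)) :=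
          hwe.trans (one_div_pow_four_le_one_add hd)
        have hsq : ‖a y‖ ^ 2 ≤ ‖a y‖ ^ 3 + 1 := sq_le_cube_add_one (norm_nonneg _)
        have hc0 : 0 ≤ ‖a y‖ ^ 3 := by positivity
        have h2 : C * (σ + ‖x - y‖ ^ 2) ^ (-e) * ‖a y‖ ^ 2 ≤ h₂ y + h₃ y := by
          rw [hh₂, hh₃]
          simp only [Set.indicator_of_mem hyB]
          calc C * (σ + ‖x - y‖ ^ 2) ^ (-e) * ‖a y‖ ^ 2
              ≤ C * (σ + ‖x - y‖ ^ 2) ^ (-e) * (‖a y‖ ^ 3 + 1) :=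
                mul_le_mul_of_nonneg_left hsq (by positivity)
            _ = C * ((σ + ‖x - y‖ ^ 2) ^ (-e) * ‖a y‖ ^ 3) + C * (σ + ‖x - y‖ ^ 2) ^ (-e) := by ring
            _ ≤ C * (256 * ‖a y‖ ^ 3) + C * (625 * (1 + ‖x - y‖) ^ (-(4 : ℝ))) := by
                gcongr
            _ = 256 * C * ‖a y‖ ^ 3 + 625 * C * (1 + ‖x - y‖) ^ (-(4 : ℝ)) := by ring
        linarith [hk', h2, hnn₁ y, hnn₄ y]
      · -- far source: `‖y‖ ≥ R ≥ 1`, distance `≥ ‖y‖/2`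
        have hyR' : R ≤ ‖y‖ := not_lt.1 hyR
        have hd : ‖y‖ / 2 ≤ ‖x - y‖ := by
          linarith [norm_sub_norm_le y x, norm_sub_rev x y, hx, hR.trans hyR']
        have hwe : (σ + ‖x - y‖ ^ 2) ^ (-e) ≤
            16 * (2 : ℝ) ^ (7 / 2 : ℝ) * R ^ (-(1 / 2 : ℝ)) * (1 + ‖y‖) ^ (-(7 / 2 : ℝ)) := by
          rw [he]; exact weight_far_le hσ hR hyR' hd
        have ha2 : ‖a y‖ ^ 2 ≤ Mf ^ 2 := pow_le_pow_left₀ (norm_nonneg _) (hfar y) 2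
        have h4 : C * (σ + ‖x - y‖ ^ 2) ^ (-e) * ‖a y‖ ^ 2 ≤ h₄ y := by
          rw [hh₄, hL_def]
          have hw7 : 0 ≤ (1 + ‖y‖) ^ (-(7 / 2 : ℝ)) := Real.rpow_nonneg (by positivity) _
          have hRh : 0 ≤ R ^ (-(1 / 2 : ℝ)) := Real.rpow_nonneg (by linarith) _
          calc C * (σ + ‖x - y‖ ^ 2) ^ (-e) * ‖a y‖ ^ 2
              ≤ C * (16 * (2 : ℝ) ^ (7 / 2 : ℝ) * R ^ (-(1 / 2 : ℝ)) * (1 + ‖y‖) ^ (-(7 / 2 : ℝ))) *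
                  Mf ^ 2 := by gcongr
            _ = 16 * (2 : ℝ) ^ (7 / 2 : ℝ) * C * Mf ^ 2 * R ^ (-(1 / 2 : ℝ)) *
                  (1 + ‖y‖) ^ (-(7 / 2 : ℝ)) := by ring
        linarith [hk', h4, hnn₁ y, hnn₂ y, hnn₃ y]
  -- integrate the majorant
  rw [oseenSlice_apply]
  have hhint : Integrable (fun y => ((h₁ y + h₂ y) + h₃ y) + h₄ y) := ((hi₁.add hi₂).add hi₃).add hi₄
  refine (norm_integral_le_of_norm_le hhint (Eventually.of_forall hptw)).trans ?_
  have e1 : ∫ y, h₁ y + h₂ y + h₃ y + h₄ y = (∫ y, h₁ y + h₂ y + h₃ y) + ∫ y, h₄ y :=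
    integral_add ((hi₁.add hi₂).add hi₃) hi₄
  have e2 : ∫ y, h₁ y + h₂ y + h₃ y = (∫ y, h₁ y + h₂ y) + ∫ y, h₃ y := integral_add (hi₁.add hi₂) hi₃
  have e3 : ∫ y, h₁ y + h₂ y = (∫ y, h₁ y) + ∫ y, h₂ y := integral_add hi₁ hi₂
  rw [e1, e2, e3]
  -- evaluate / bound the four integrals
  have hI₁ : ∫ y, h₁ y = C * P * I * σ ^ (-(1 / 2 : ℝ)) := by
    rw [hh₁, integral_const_mul]
    have hW := integral_sub_left_eq_self (fun z : EuclideanSpace ℝ (Fin 3) => (σ + ‖z‖ ^ 2) ^ (-e)) volume x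
    rw [hW, integral_add_norm_sq_rpow_neg_half_succ hσ, hI_def]
    ring
  have hI₂ : ∫ y, h₂ y ≤ 256 * C * Q := by
    rw [hh₂, integral_const_mul, integral_indicator hBm]
    exact mul_le_mul_of_nonneg_left hQ (by positivity)
  have hI₃ : ∫ y, h₃ y = 625 * C * jFour := by
    rw [hh₃, integral_const_mul]
    have hW := integral_sub_left_eq_self (fun z : EuclideanSpace ℝ (Fin 3) => (1 + ‖z‖) ^ (-(4 : ℝ))) volume x
    rw [hW, jFour]
  have hI₄ : ∫ y, h₄ y = L * jSeven := by
    rw [hh₄, integral_const_mul, jSeven]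
  rw [hI₁, hI₃, hI₄, hL_def]
  linarith [hI₂]



end Summit.NavierStokesRegularity.NavierStokesRegularity.Cruxes.TypeIQuantSubcubicExp.QuietCore

end
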